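import Literature.AlgebraicGeometry.HodgeTheory.DirectImageBaseChange
import HarnessLib

/-!
# Base change of the local system `Rᵏ π_* ℂ` along an ARBITRARY morphism of bases

Family `hodge`, layer `Literature/AlgebraicGeometry/HodgeTheory`; theorems only (no definition, no
named fact).

`DirectImageBaseChange.lean` proves that the transfer of fibre classes
`FiberClass.baseChange π g k : FiberClass π' k → FiberClass π k`, `(s', β) ↦ (g s', (X_{g s'} ≅ X'_{s'})^* β)`
(`π' = familyPullback.snd π g : 𝒳 ×_S S' ⟶ S'`), is continuous for the étalé topologies, and that
transport commutes with base change, under the hypothesis that `g(ℂ) : S'(ℂ) → S(ℂ)` is a LOCAL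
HOMEOMORPHISM (a chart of `g(ℂ)` turns the projection of tubes into a homeomorphism). Voisin's
statement (Hodge Theory II, §3.1.1: "if `i : Y → X` is a continuous map and `𝓕` is a local system
… then `i⁻¹(𝓕)` is a local system"; §3.1.2: the monodromy along `γ` is computed in the fibred
product `Y_γ → [0,1]`) has no such restriction, and base-changing a family along a CLOSED
IMMERSION of bases (restricting a family to a subvariety of the base through a point) is the
other case the Hodge-locus arguments need. This file removes the hypothesis on `g`, replacing the
tube homeomorphism by the cohomological local triviality of BOTH families (for smooth projective
families this is Ehresmann's theorem, PROVED in the tree: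
`isCohomologicallyLocallyTrivialOn_univ_of_isSmoothProjectiveFamily`, and it is preserved by base
change since `π'` is again smooth projective):

* `map_inv_fiberRestrict_map_tubeBaseChangeMap` — chart-free naturality: restricting the
  pulled-back tube class `pr^* ζ` to `X'_v` and transferring to `X_{g v}` gives `ζ|_{X_{g v}}`;
* `FiberClass.continuous_baseChange_of_isCohomologicallyLocallyTrivialOn` — **the transfer is
  continuous for every `g`** when `π` and `π'` are cohomologically locally trivial over all of
  `S(ℂ)`, `S'(ℂ)`: a local section `t ↦ ξ'|_{X'_t}` of `Rᵏ π'_* ℂ` and the pull-back of the local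
  section of `Rᵏ π_* ℂ` through the transfer of `ξ'|_{X'_{v₀}}` are two local sections of
  `Rᵏ π'_* ℂ` agreeing at `v₀`, hence near `v₀` (sheets of the étalé space), so that near `v₀` the
  transfer of the former is the latter composed with `g(ℂ)`;
* `FiberClass.baseChange_transportFun_of_isCohomologicallyLocallyTrivialOn` — **transport commutes
  with base change along every `g`** (same proof as the local-homeomorphism case: push the lift of
  `γ'` forward by the continuous transfer; uniqueness of lifts);
* `IsContinuationAlong.baseChange` — corollary in the language of continuations: a continuation
  along a path `γ'` in the base-changed family transfers to a continuation along `g ∘ γ'`; hence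
  `finite_setOf_isContinuationAlong_baseChange_of_finite` — **a finite monodromy orbit stays
  finite after any base change** (the orbit upstairs injects into the orbit downstairs): the form
  in which "restricting the family to a subvariety of the base can only shrink the monodromy" is
  used.

## References

* [VoisinHodgeII2003] C. Voisin, Hodge Theory and Complex Algebraic Geometry II, CUP 2003, §3.1.1
  (inverse image of a local system), §3.1.2 (the fibred product `Y_γ`).
* [VoisinHodgeI2002] C. Voisin, Hodge Theory and Complex Algebraic Geometry I, CUP 2002, §9.2.1.
* [HatcherAT2002] A. Hatcher, Algebraic Topology, CUP 2002, Prop. 1.34 (uniqueness of lifts).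
-/

noncomputable section

open CategoryTheory AlgebraicGeometry
open _root_.Topology _root_.Filter
open Literature.AlgebraicTopology.SingularHomology

namespace Literature.AlgebraicGeometry.HodgeTheory

section HodgeTheory

variable {𝒳 S S' : Motives.SchemeOver ℂ} (π : 𝒳 ⟶ S) (g : S' ⟶ S)

/-- **Chart-free naturality of the tube map with restriction to fibres**: for a tube class `ζ` of
`π` over `g(V)`, restricting its pull-back along the projection of tubes `π'⁻¹V → π⁻¹(g V)` to the
fibre `X'_v` and transferring along `X_{g v} ≅ X'_v` gives the restriction of `ζ` to `X_{g v}`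
(`tubeBaseChangeMap_fiberToTube` in cohomology). [cite: VoisinHodgeII2003, §3.1.1] -/
theorem map_inv_fiberRestrict_map_tubeBaseChangeMap {V : Set (Motives.ComplexPoints S')} (k : ℕ)
    (ζ : singularCohomology ℂ ℂ (tubeOver π (Motives.AlgPoints.map g '' V)) k)
    {v : Motives.ComplexPoints S'} (hv : v ∈ V) :
    complexBetti.map (Motives.fiberOverFamilyPullbackIso π g v).inv k
        (fiberRestrict (Motives.familyPullback.snd π g) hv k
          (singularCohomology.map ℂ ℂ (tubeBaseChangeMap π g V) k ζ)) =
      fiberRestrict π (Set.mem_image_of_mem _ hv) k ζ := by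
  have hmaps : (tubeBaseChangeMap π g V).comp
      ((fiberToTube (Motives.familyPullback.snd π g) hv).comp
        (Motives.AlgPoints.mapContinuous (Motives.fiberOverFamilyPullbackIso π g v).inv)) =
      fiberToTube π (Set.mem_image_of_mem _ hv) := by
    ext P : 1
    exact tubeBaseChangeMap_fiberToTube π g hv P
  change (singularCohomology.map ℂ ℂ (tubeBaseChangeMap π g V) k ≫
      fiberRestrict (Motives.familyPullback.snd π g) hv k ≫
        complexBetti.map (Motives.fiberOverFamilyPullbackIso π g v).inv k) ζ = _
  rw [fiberRestrict, fiberRestrict, complexBetti.map, ← singularCohomology.map_comp,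
    ← singularCohomology.map_comp, hmaps]

/-- The transfer `(e_v⁻¹)^*` along the fibre isomorphism is injective on classes (it is inverted
by `(e_v)^*`). [folklore] -/
theorem complexBetti_map_fiberOverFamilyPullbackIso_inv_injective (v : Motives.ComplexPoints S')
    (k : ℕ) :
    Function.Injective (complexBetti.map (Motives.fiberOverFamilyPullbackIso π g v).inv k) := by
  intro x y hxy
  have hx := (Motives.fiberOverFamilyPullbackIso π g v).complexBetti_map_hom_map_inv k x
  have hy := (Motives.fiberOverFamilyPullbackIso π g v).complexBetti_map_hom_map_inv k y
  rw [← hx, ← hy, hxy]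

/-- **The transfer of fibre classes is continuous along EVERY base change** when the direct
images of `π` and of `π' = familyPullback.snd π g` are cohomologically locally trivial over all of
`S(ℂ)` and `S'(ℂ)` (no local-homeomorphism hypothesis on `g(ℂ)`; compare
`FiberClass.continuous_baseChange`). Proof: by the universal property of the étalé topology it
suffices to treat a local section `v ↦ (v, ξ'|_{X'_v})` over an open `B' ⊆ S'(ℂ)`; at `v₀ ∈ B'`
choose a trivialising open `B ∋ g v₀` of `π` and the tube class `ζ` over `B` with
`ζ|_{X_{g v₀}} = (e⁻¹)^* ξ'|_{X'_{v₀}}`; over `V = B' ∩ g⁻¹B` the classes `ξ'|_V` and `pr^*(ζ|_{gV})`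
are two tube classes of `π'` with the same restriction to `X'_{v₀}`
(`map_inv_fiberRestrict_map_tubeBaseChangeMap`), hence the same restriction to a trivialising
`B'' ∋ v₀` of `π'`, hence the same fibre restrictions over `B''`; so near `v₀` the transfer of the
local section is the local section `t ↦ (t, ζ|_{X_t})` of `π` evaluated at `g v`, which is
continuous (`FiberClass.continuousAt_of_eventually_eq_tubeSection`).
[cite: VoisinHodgeII2003, §3.1.1] [cite: VoisinHodgeI2002, §9.2.1] -/
theorem FiberClass.continuous_baseChange_of_isCohomologicallyLocallyTrivialOn
    (hU : IsCohomologicallyLocallyTrivialOn π Set.univ)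
    (hU' : IsCohomologicallyLocallyTrivialOn (Motives.familyPullback.snd π g) Set.univ) (k : ℕ) :
    Continuous (FiberClass.baseChange π g k) := by
  set π' := Motives.familyPullback.snd π g with hπ'
  refine continuous_iSup_dom.2 fun B' => continuous_iSup_dom.2 fun ξ' =>
    continuous_coinduced_dom.2 ?_
  refine continuous_iff_continuousAt.2 fun v₀ => ?_
  -- a trivialising open `B ∋ g v₀` of `π`, and the tube class `ζ` over `B` through the transfer
  obtain ⟨B, hBo, hgB, -, -, hbij⟩ := hU.exists_nhds_bijective
    (Set.mem_univ (Motives.AlgPoints.map g v₀.1)) Set.univ univ_mem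
  obtain ⟨ζ, hζ⟩ := (hbij k hgB).2
    (complexBetti.map (Motives.fiberOverFamilyPullbackIso π g v₀.1).inv k (fiberRestrict π' v₀.2 k ξ'))
  -- the open `V = B' ∩ g⁻¹ B ∋ v₀`
  set V : Set (Motives.ComplexPoints S') :=
    (B' : Set (Motives.ComplexPoints S')) ∩ Motives.AlgPoints.map g ⁻¹' B with hVdef
  have hVo : IsOpen V := B'.2.inter (hBo.preimage (Motives.AlgPoints.continuous_map g))
  have hv₀V : v₀.1 ∈ V := ⟨v₀.2, hgB⟩
  have hVB' : V ⊆ (B' : Set (Motives.ComplexPoints S')) := Set.inter_subset_left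
  have hgVB : Motives.AlgPoints.map g '' V ⊆ B := by
    rintro _ ⟨v, hv, rfl⟩
    exact hv.2
  -- two tube classes of `π'` over `V`: the restriction of `ξ'`, and the pull-back of `ζ|_{g V}`
  set ξV : singularCohomology ℂ ℂ (tubeOver π' V) k :=
    singularCohomology.map ℂ ℂ (tubeInclusion π' hVB') k ξ' with hξV
  set ζV : singularCohomology ℂ ℂ (tubeOver π' V) k :=
    singularCohomology.map ℂ ℂ (tubeBaseChangeMap π g V) k
      (singularCohomology.map ℂ ℂ (tubeInclusion π hgVB) k ζ) with hζV
  -- they agree on the fibre `X'_{v₀}`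
  have h₀ : fiberRestrict π' hv₀V k ζV = fiberRestrict π' hv₀V k ξV := by
    apply complexBetti_map_fiberOverFamilyPullbackIso_inv_injective π g v₀.1 k
    rw [hζV, map_inv_fiberRestrict_map_tubeBaseChangeMap π g k _ hv₀V,
      fiberRestrict_map_tubeInclusion, hξV, fiberRestrict_map_tubeInclusion]
    exact hζ
  -- hence on a trivialising open `B'' ∋ v₀` of `π'` inside `V`
  obtain ⟨B'', hB''o, hv₀B'', hB''V, -, hbij'⟩ :=
    hU'.exists_nhds_bijective (Set.mem_univ v₀.1) V (hVo.mem_nhds hv₀V)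
  have hagree : singularCohomology.map ℂ ℂ (tubeInclusion π' hB''V) k ζV =
      singularCohomology.map ℂ ℂ (tubeInclusion π' hB''V) k ξV :=
    (hbij' k hv₀B'').1 (by rw [fiberRestrict_map_tubeInclusion, fiberRestrict_map_tubeInclusion, h₀])
  have hfib : ∀ ⦃v : Motives.ComplexPoints S'⦄ (hv : v ∈ B''),
      fiberRestrict π' (hB''V hv) k ζV = fiberRestrict π' (hB''V hv) k ξV := fun v hv ↦ by
    rw [← fiberRestrict_map_tubeInclusion π' k hB''V hv ζV, hagree, fiberRestrict_map_tubeInclusion]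
  -- near `v₀` the transferred section is the local section of `π` given by `ζ`, at `g v`
  refine FiberClass.continuousAt_of_eventually_eq_tubeSection
    (Φ := fun v : B' => FiberClass.baseChange π g k (tubeSection π' k B' ξ' v)) ?_ hBo ζ ?_
  · change ContinuousAt (fun v : B' => Motives.AlgPoints.map g v.1) v₀
    exact ((Motives.AlgPoints.continuous_map g).comp continuous_subtype_val).continuousAt
  · have hnhds : {v : B' | v.1 ∈ B''} ∈ 𝓝 v₀ := (hB''o.preimage continuous_subtype_val).mem_nhds hv₀B''
    filter_upwards [hnhds] with v hv
    have hvV : v.1 ∈ V := hB''V hv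
    refine ⟨hvV.2, ?_⟩
    change (⟨Motives.AlgPoints.map g v.1, complexBetti.map (Motives.fiberOverFamilyPullbackIso π g v.1).inv k
        (fiberRestrict π' v.2 k ξ')⟩ : FiberClass π k) =
      ⟨Motives.AlgPoints.map g v.1, fiberRestrict π hvV.2 k ζ⟩
    congr 1
    have h1 : fiberRestrict π' v.2 k ξ' = fiberRestrict π' hvV k ξV := by
      rw [hξV, fiberRestrict_map_tubeInclusion]
    rw [h1, ← hfib hv, hζV, map_inv_fiberRestrict_map_tubeBaseChangeMap π g k _ hvV,
      fiberRestrict_map_tubeInclusion]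
    rfl

/-- **Transport commutes with base change along EVERY morphism of bases** (compare
`FiberClass.baseChange_transportFun`, which assumes `g(ℂ)` a local homeomorphism): `π` and `π'`
cohomologically locally trivial over all of `S(ℂ)`, `S'(ℂ)`, `γ'` a path in `S'(ℂ)` over the path
`γ` in `S(ℂ)`, `α'` a class on `X'_{s'}` whose transfer is the fibre class `(s, α)`: then
`(t, γ_* α)` is the transfer of `(t', γ'_* α')` — push the lift of `γ'` through `(s', α')` forward
by the continuous transfer (`FiberClass.continuous_baseChange_of_isCohomologicallyLocallyTrivialOn`)
and use uniqueness of lifts. [cite: VoisinHodgeII2003, §3.1.2] [cite: HatcherAT2002, Prop. 1.34] -/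
theorem FiberClass.baseChange_transportFun_of_isCohomologicallyLocallyTrivialOn
    (hU : IsCohomologicallyLocallyTrivialOn π Set.univ)
    (hU' : IsCohomologicallyLocallyTrivialOn (Motives.familyPullback.snd π g) Set.univ) (k : ℕ)
    {s t : (Set.univ : Set (Motives.ComplexPoints S))} (γ : Path s t)
    {s' t' : (Set.univ : Set (Motives.ComplexPoints S'))} (γ' : Path s' t')
    (hγ : ∀ u, Motives.AlgPoints.map g (γ' u).1 = (γ u).1)
    (α' : complexBetti (Motives.fiberOver (Motives.familyPullback.snd π g) s'.1) k)
    {α : complexBetti (Motives.fiberOver π s.1) k}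
    (h₀ : (⟨s.1, α⟩ : FiberClass π k) = FiberClass.baseChange π g k ⟨s'.1, α'⟩) :
    (⟨t.1, transportFun π k hU ⟦γ⟧ α⟩ : FiberClass π k) =
      FiberClass.baseChange π g k
        ⟨t'.1, transportFun (Motives.familyPullback.snd π g) k hU' ⟦γ'⟧ α'⟩ := by
  obtain ⟨Γ', hΓ'⟩ := exists_path_transportFun (Motives.familyPullback.snd π g) k hU' γ' α'
  set y : FiberClass π k := FiberClass.baseChange π g k
    ⟨t'.1, transportFun (Motives.familyPullback.snd π g) k hU' ⟦γ'⟧ α'⟩ with hy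
  have hyt : y.pt = t.1 := by
    rw [hy, FiberClass.pt_baseChange]
    have h1 := hγ 1
    rwa [γ'.target, γ.target] at h1
  have hcont : Continuous fun u => FiberClass.baseChange π g k (Γ' u) :=
    (FiberClass.continuous_baseChange_of_isCohomologicallyLocallyTrivialOn π g hU hU' k).comp
      Γ'.continuous
  let Γ : Path (⟨s.1, α⟩ : FiberClass π k) ⟨t.1, y.clsAt hyt⟩ :=
    { toFun := fun u => FiberClass.baseChange π g k (Γ' u)
      continuous_toFun := hcont
      source' := by rw [Γ'.source, h₀]
      target' := by rw [Γ'.target, FiberClass.mk_clsAt] }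
  have hΓ : ∀ u, (Γ u).pt = (γ u).1 := fun u => by
    change Motives.AlgPoints.map g (Γ' u).pt = (γ u).1
    rw [hΓ' u, hγ u]
  rw [transportFun_eq_of_path π k hU γ Γ hΓ, FiberClass.mk_clsAt]

/-! ### Continuations and monodromy orbits under base change -/

/-- **Continuations transfer along every base change.** With `π`, `π'` cohomologically locally
trivial over `S(ℂ)`, `S'(ℂ)`: if `β'` is a flat continuation of `α'` along the path `γ'` in
`S'(ℂ)` (base-changed family), then the transfer `(e_{t'}⁻¹)^* β'` is a flat continuation of the
transfer `(e_{s'}⁻¹)^* α'` along `g ∘ γ'` in `S(ℂ)` — push the lifting path forward by the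
continuous transfer (`FiberClass.continuous_baseChange_of_isCohomologicallyLocallyTrivialOn`).
[cite: VoisinHodgeII2003, §3.1.2] -/
theorem IsContinuationAlong.baseChange
    (hU : IsCohomologicallyLocallyTrivialOn π Set.univ)
    (hU' : IsCohomologicallyLocallyTrivialOn (Motives.familyPullback.snd π g) Set.univ) (k : ℕ)
    {s' t' : Motives.ComplexPoints S'} {γ' : Path s' t'}
    {α' : complexBetti (Motives.fiberOver (Motives.familyPullback.snd π g) s') k}
    {β' : complexBetti (Motives.fiberOver (Motives.familyPullback.snd π g) t') k}
    (h : IsContinuationAlong γ' α' β') :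
    IsContinuationAlong (γ'.map (Motives.AlgPoints.continuous_map g))
      (complexBetti.map (Motives.fiberOverFamilyPullbackIso π g s').inv k α')
      (complexBetti.map (Motives.fiberOverFamilyPullbackIso π g t').inv k β') := by
  obtain ⟨Γ', hΓ'⟩ := h
  have hcont : Continuous fun u => FiberClass.baseChange π g k (Γ' u) :=
    (FiberClass.continuous_baseChange_of_isCohomologicallyLocallyTrivialOn π g hU hU' k).comp
      Γ'.continuous
  refine ⟨{ toFun := fun u => FiberClass.baseChange π g k (Γ' u)
            continuous_toFun := hcont
            source' := by rw [Γ'.source]; rfl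
            target' := by rw [Γ'.target]; rfl }, fun u => ?_⟩
  change Motives.AlgPoints.map g (Γ' u).pt = Motives.AlgPoints.map g (γ' u)
  rw [hΓ' u]

/-- **A finite monodromy orbit stays finite after every base change.** With `π`, `π'`
cohomologically locally trivial over `S(ℂ)`, `S'(ℂ)`, a complex point `s'` of `S'` and a class
`α ∈ Hᵏ(X_{g s'})`: if the set of flat continuations of `α` along loops at `g s'` is finite, so is
the set of flat continuations of its transfer `e^* α ∈ Hᵏ(X'_{s'})` along loops at `s'` in the
base-changed family — the transfer `(e⁻¹)^*` maps the latter injectively into the former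
(`IsContinuationAlong.baseChange`). This is the form in which "restricting the family to a
subvariety of the base through the point (or pulling it back along any morphism) can only shrink
the monodromy" is used. [cite: VoisinHodgeII2003, §3.1.1 and §3.1.2] -/
theorem finite_setOf_isContinuationAlong_baseChange_of_finite
    (hU : IsCohomologicallyLocallyTrivialOn π Set.univ)
    (hU' : IsCohomologicallyLocallyTrivialOn (Motives.familyPullback.snd π g) Set.univ) (k : ℕ)
    (s' : Motives.ComplexPoints S')
    (α : complexBetti (Motives.fiberOver π (Motives.AlgPoints.map g s')) k)
    (hfin : {β : complexBetti (Motives.fiberOver π (Motives.AlgPoints.map g s')) k |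
      ∃ γ : Path (Motives.AlgPoints.map g s') (Motives.AlgPoints.map g s'),
        IsContinuationAlong γ α β}.Finite) :
    {β' : complexBetti (Motives.fiberOver (Motives.familyPullback.snd π g) s') k |
      ∃ γ' : Path s' s', IsContinuationAlong γ'
        (complexBetti.map (Motives.fiberOverFamilyPullbackIso π g s').hom k α) β'}.Finite := by
  set e := Motives.fiberOverFamilyPullbackIso π g s' with he
  refine Set.Finite.of_finite_image (f := complexBetti.map e.inv k) (hfin.subset ?_)
    ((complexBetti_map_fiberOverFamilyPullbackIso_inv_injective π g s' k).injOn)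
  rintro _ ⟨β', ⟨γ', hγ'⟩, rfl⟩
  refine ⟨γ'.map (Motives.AlgPoints.continuous_map g), ?_⟩
  have h := IsContinuationAlong.baseChange π g hU hU' k hγ'
  rwa [he, e.complexBetti_map_inv_map_hom] at h

end HodgeTheory

end Literature.AlgebraicGeometry.HodgeTheory

end
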